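import Mathlib
import HarnessLib
import Summits.HubbardSuperconductivity.HubbardSuperconductivity.Theorems.KLProgrammeKLRegimeWickCrossContractionFat
import Summits.HubbardSuperconductivity.HubbardSuperconductivity.Theorems.KLProgrammeKLRegimeAlphaRegime

/-!
# Route `KLProgramme` — ENGINE child stmt-HubbardSuperconductivity-20236 `KLRegimeEngineV16`, `stub_engine_step_values` (E.5 / `CR` classes): the
# `k + 1`-line two-vertex term on fat sector fields with ALL LINE CONSTANTS DISCHARGED — `α` (p523001) and `δ = κ²` (p515376) — leaving only the
# vertex norms `Na`, `Nb` (the engine's own (E1) invariants)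

Cell gate-hubbard-kl, seat hubbard-kl-k3c2-p3 (g4, row «sector-counting import (DR2000 L11/L12) for the leg-dress bar»).  Composition of
`sum_norm_kernel_crossLaplacian_pow_bgmFat_le(_of_eq_one)` (…WickCrossContractionFat §1, p5's pulled-back bound keyed on the fat family, `ρ₀ = 9`) with
the regime-keyed line constants of this lineage for the engine slice `g_{n+j} = klSliceCov L M β μ K (n + j)` against the fat family of index `n`:
`α` = `alpha_klSliceCov_bgmFat_klEng j` (row AND column sums `≤ Cα·(M/β)/Λ_{n+j}`), `δ` = `gram_entry_klSliceCov_bgmFat_klEng` (entries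
`≤ Cκ·(Λ_n/Λ_{n+j})·e₀·8^{-n}`):

* **`sum_norm_kernel_crossLaplacian_pow_klSliceCov_bgmFat_klEng_closed (j)`** / **`…_closed_of_eq_one (j)`** — `∃ C > 0` (`= Cα`) and `∃ D > 0` (`= Cκ`):
  under EXACTLY the gen-6 stub binders, for `1 ≤ n`, `n + j ≤ nScales β + 1`, every `k d m₀ m₁ a b s p z` and vertex norms `Na`, `Nb`:
  `Σ_{Z : Z p = z} ‖kernel ((Δ_×(S(Ft_n)ᵀ g_{n+j} S(Ft_n)))^{k+1} (a⁰ b¹)) d (Z,s)‖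
     ≤ ((k+1+m₀)!(k+1+m₁)!/d!) · ((C·(M/β)/Λ_{n+j}) · (36·(D·(Λ_n/Λ_{n+j})·e₀·8^{-n}))^k · Na · Nb)`.
  With `ε_x = β/(2M)` and the `ε`-weights of the vertex norms this is FKT Prop. XII / BGM (2.83) at scale `n` for the `k+1`-line classes: one line in
  `L¹` (`ε_x·α = O(1/Λ)`), `k` lines in sup (`8^{-n}` each), by name.  By SECTOR-RADIAL-ALIGNMENT the plateau-consistent step reads `j = 2`.

Pure composition; no definitions, no named facts. [cite: BenfattoGiulianiMastropietro2006, §2.8 (2.80)–(2.83)]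
-/

noncomputable section

namespace Summit.HubbardSuperconductivity.HubbardSuperconductivity.Theorems.KLRegimeWick

set_option linter.dupNamespace false -- summit = problem name (single-conjunct summit), D-0017

open Literature.MathematicalPhysics.QuantumLattice Literature.Probability.LatticeModels GrassmannAlgebra Finset Matrix
open Summit.HubbardSuperconductivity.HubbardSuperconductivity.Theorems.KLProgrammeLegKernels
open Summit.HubbardSuperconductivity.HubbardSuperconductivity.Theorems.KLRegimeSplit
open Summit.HubbardSuperconductivity.HubbardSuperconductivity.Theorems.TorusFourierL2

/-- **The `k + 1`-line two-vertex term of the engine with all line constants discharged, pinned at a free leg of `a`.**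
[cite: BenfattoGiulianiMastropietro2006, §2.8 (2.80)–(2.83)] -/
theorem sum_norm_kernel_crossLaplacian_pow_klSliceCov_bgmFat_klEng_closed (j : ℕ) :
    ∃ C : ℝ, 0 < C ∧ ∃ D : ℝ, 0 < D ∧ ∀ (P : SplitConsts) (R : RenConsts) (c : ℝ), P.WF → R.WF2 → 0 < c → c ≤ EngineV8.klEngC₃3 P R →
      ∀ μ ∈ klWindowC, ∀ U : ℝ, 0 < U → U ≤ EngineV8.klEngU₀4 P R c → ∀ β : ℝ, klBetaMin ≤ β → β ≤ Real.exp (c / U ^ 2) →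
      ∀ K : TrigPolyC4v, FrameOK R U (nScales β) μ K → ∀ (L M : ℕ) [NeZero L] [NeZero M],
      EngineV8.klEngL₃ β U ≤ L → EngineV8.klEngM₃ β U L ≤ M → ∀ n : ℕ, 1 ≤ n → n + j ≤ nScales β + 1 →
      ∀ (k d m₀ m₁ : ℕ) (a b : GrassmannAlgebra ℂ (SpaceTimeIdx L M × SectorLeg (sectorCount n))) (s : Fin d → Fin 2),
        (univ.filter fun i => s i = 0).card = m₀ → (univ.filter fun i => s i = 1).card = m₁ → ∀ p : Fin d, s p = 0 →
        ∀ (z : SpaceTimeIdx L M × SectorLeg (sectorCount n)) (Na Nb : ℝ), 0 ≤ Nb →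
        (∀ p₀ : Fin m₀, ∑ X : Fin (k + 1) → SpaceTimeIdx L M × SectorLeg (sectorCount n),
          ∑ X₀ ∈ univ.filter (fun X₀ : Fin m₀ → SpaceTimeIdx L M × SectorLeg (sectorCount n) => X₀ p₀ = z),
            ‖kernel ℂ a (k + 1 + m₀) (Fin.append X X₀)‖ ≤ Na) →
        (∀ (Y₀ : SpaceTimeIdx L M × SectorLeg (sectorCount n)) (τ : Fin k → SectorLeg (sectorCount n)),
          ∑ y : Fin k → SpaceTimeIdx L M, ∑ Y₁ : Fin m₁ → SpaceTimeIdx L M × SectorLeg (sectorCount n),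
            ‖kernel ℂ b (k + 1 + m₁) (Fin.append
              (Fin.cons Y₀ (fun i => (y i, τ i)) : Fin (k + 1) → SpaceTimeIdx L M × SectorLeg (sectorCount n)) Y₁)‖ ≤ Nb) →
        ∑ Z ∈ univ.filter (fun Z : Fin d → SpaceTimeIdx L M × SectorLeg (sectorCount n) => Z p = z),
            ‖kernel ℂ (((grassmannLaplacian ℂ (crossCov ℂ
                ((sectorSubMatrix L M β (bgmFatMultiplier L M klE0 β (nambuXiCT L μ K) n)).transpose * klSliceCov L M β μ K (n + j) *
                  sectorSubMatrix L M β (bgmFatMultiplier L M klE0 β (nambuXiCT L μ K) n)))) ^ (k + 1))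
              (dblCopy ℂ 0 a * dblCopy ℂ 1 b)) d (fun i => (Z i, s i))‖ ≤
          (((k + 1 + m₀).factorial * (k + 1 + m₁).factorial : ℝ) / d.factorial) *
            ((C * ((M : ℝ) / β) / klScale klE0 (n + j)) *
              (36 * (D * (klScale klE0 n / klScale klE0 (n + j)) * (klE0 * ((8 : ℝ) ^ n)⁻¹))) ^ k * Na * Nb) := by
  obtain ⟨C, hC, hα⟩ := alpha_klSliceCov_bgmFat_klEng j
  obtain ⟨D, hD, hδ⟩ := sum_norm_kernel_crossLaplacian_pow_klSliceCov_bgmFat_klEng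
  refine ⟨C, hC, D, hD, ?_⟩
  intro P R c hP hR2 hc hc3 μ hμ U hU hU0 β hβmin hβc K hK L M _ _ hL3 hM3 n hn hnN k d m₀ m₁ a b s hm₀ hm₁ p hp z Na Nb hNb0 hNa hNb
  obtain ⟨hrow, hcol⟩ := hα P R c hP hR2 hc hc3 μ hμ U hU hU0 β hβmin hβc K hK L M hL3 hM3 n hn hnN
  exact hδ P R c hP hR2 hc hc3 μ hμ U hU hU0 β hβmin hβc K hK L M hL3 hM3 n hn (by omega) (n + j) (by omega) k d m₀ m₁ a b s hm₀ hm₁ p hp z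
    (C * ((M : ℝ) / β) / klScale klE0 (n + j)) hrow hcol Na Nb hNb0 hNa hNb

/-- **The same, pinned at a free leg of `b`.** [cite: BenfattoGiulianiMastropietro2006, §2.8 (2.80)–(2.83)] -/
theorem sum_norm_kernel_crossLaplacian_pow_klSliceCov_bgmFat_klEng_closed_of_eq_one (j : ℕ) :
    ∃ C : ℝ, 0 < C ∧ ∃ D : ℝ, 0 < D ∧ ∀ (P : SplitConsts) (R : RenConsts) (c : ℝ), P.WF → R.WF2 → 0 < c → c ≤ EngineV8.klEngC₃3 P R →
      ∀ μ ∈ klWindowC, ∀ U : ℝ, 0 < U → U ≤ EngineV8.klEngU₀4 P R c → ∀ β : ℝ, klBetaMin ≤ β → β ≤ Real.exp (c / U ^ 2) →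
      ∀ K : TrigPolyC4v, FrameOK R U (nScales β) μ K → ∀ (L M : ℕ) [NeZero L] [NeZero M],
      EngineV8.klEngL₃ β U ≤ L → EngineV8.klEngM₃ β U L ≤ M → ∀ n : ℕ, 1 ≤ n → n + j ≤ nScales β + 1 →
      ∀ (k d m₀ m₁ : ℕ) (a b : GrassmannAlgebra ℂ (SpaceTimeIdx L M × SectorLeg (sectorCount n))) (s : Fin d → Fin 2),
        (univ.filter fun i => s i = 0).card = m₀ → (univ.filter fun i => s i = 1).card = m₁ → ∀ p : Fin d, s p = 1 →
        ∀ (z : SpaceTimeIdx L M × SectorLeg (sectorCount n)) (Na Nb : ℝ), 0 ≤ Na →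
        (∀ (X₀ : SpaceTimeIdx L M × SectorLeg (sectorCount n)) (σ : Fin k → SectorLeg (sectorCount n)),
          ∑ x : Fin k → SpaceTimeIdx L M, ∑ Z₀ : Fin m₀ → SpaceTimeIdx L M × SectorLeg (sectorCount n),
            ‖kernel ℂ a (k + 1 + m₀) (Fin.append
              (Fin.cons X₀ (fun i => (x i, σ i)) : Fin (k + 1) → SpaceTimeIdx L M × SectorLeg (sectorCount n)) Z₀)‖ ≤ Na) →
        (∀ p₁ : Fin m₁, ∑ Y : Fin (k + 1) → SpaceTimeIdx L M × SectorLeg (sectorCount n),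
          ∑ Y₁ ∈ univ.filter (fun Y₁ : Fin m₁ → SpaceTimeIdx L M × SectorLeg (sectorCount n) => Y₁ p₁ = z),
            ‖kernel ℂ b (k + 1 + m₁) (Fin.append Y Y₁)‖ ≤ Nb) →
        ∑ Z ∈ univ.filter (fun Z : Fin d → SpaceTimeIdx L M × SectorLeg (sectorCount n) => Z p = z),
            ‖kernel ℂ (((grassmannLaplacian ℂ (crossCov ℂ
                ((sectorSubMatrix L M β (bgmFatMultiplier L M klE0 β (nambuXiCT L μ K) n)).transpose * klSliceCov L M β μ K (n + j) *
                  sectorSubMatrix L M β (bgmFatMultiplier L M klE0 β (nambuXiCT L μ K) n)))) ^ (k + 1))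
              (dblCopy ℂ 0 a * dblCopy ℂ 1 b)) d (fun i => (Z i, s i))‖ ≤
          (((k + 1 + m₀).factorial * (k + 1 + m₁).factorial : ℝ) / d.factorial) *
            ((C * ((M : ℝ) / β) / klScale klE0 (n + j)) *
              (36 * (D * (klScale klE0 n / klScale klE0 (n + j)) * (klE0 * ((8 : ℝ) ^ n)⁻¹))) ^ k * Na * Nb) := by
  obtain ⟨C, hC, hα⟩ := alpha_klSliceCov_bgmFat_klEng j
  obtain ⟨D, hD, hδ⟩ := sum_norm_kernel_crossLaplacian_pow_klSliceCov_bgmFat_klEng_of_eq_one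
  refine ⟨C, hC, D, hD, ?_⟩
  intro P R c hP hR2 hc hc3 μ hμ U hU hU0 β hβmin hβc K hK L M _ _ hL3 hM3 n hn hnN k d m₀ m₁ a b s hm₀ hm₁ p hp z Na Nb hNa0 hNa hNb
  obtain ⟨hrow, hcol⟩ := hα P R c hP hR2 hc hc3 μ hμ U hU hU0 β hβmin hβc K hK L M hL3 hM3 n hn hnN
  exact hδ P R c hP hR2 hc hc3 μ hμ U hU hU0 β hβmin hβc K hK L M hL3 hM3 n hn (by omega) (n + j) (by omega) k d m₀ m₁ a b s hm₀ hm₁ p hp z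
    (C * ((M : ℝ) / β) / klScale klE0 (n + j)) hrow hcol Na Nb hNa0 hNa hNb

end Summit.HubbardSuperconductivity.HubbardSuperconductivity.Theorems.KLRegimeWick

end
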